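import Mathlib
import HarnessLib
import Summits.HubbardSuperconductivity.HubbardSuperconductivity.Theorems.KLProgrammeC4aFirstOrderTubePiece

/-!
# Route `KLProgramme` — crux C4a, S3 brick (B4) «(U1)-HYBRID» B-1 (xi): THE TUBE PIECE WITH A LEVEL-DEPENDENT KERNEL — (B3)'s derivative-under-the-level-integral for a
# jointly smooth kernel family `Ψ(e, ·)`, and the first-order jet of the tube piece for a real profile and a real kernel FAMILY `K e` in the currency of `firstOrderLayer_abs_le`

Cell `gate-hubbard-kl`, seat hubbard-kl-k3c3-p3 (g37; row «implicit-function / monotonicity route for μ(n)»).  Located brick for the (C)-closer lane / the `M₁`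
assembly (stub (C) `stub_twoLeg_curvature` of `KLRegimeEngineV17F2`, stmt-HubbardSuperconductivity-20437), memo HOME/hubbard-kl-k3c3-p3/U1-CAUSTIC-SUP.md §19–§20 (B-1).

WHY.  `…C4aBubbleTubeDerivAll` (B3) factorises the tube integrand as `f(e)·J(e,φ+θ)•Ψ(ē)` with `Ψ` independent of the loop level — the per-Matsubara-frequency form
(`G_ω(e)·G_ω̄(ē)`), whose kernels are complex and NOT keyed to the loop level.  The umklapp ladder (U7), the direct parts and `…C4aFirstOrderLayerSum.firstOrderLayer_abs_le` use
a real kernel FAMILY `K e` with level-keyed envelopes (`(max |e| |u|)⁻ᵏ`) — the frequency-summed form.  This file supplies the (B3) step for that form: the integrand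
`f(e)·(J(e,φ+θ)•Ψ(e, ē))` with `Ψ : ℝ × ℝ → ℂ` jointly `C^∞` is jointly smooth (strip lemma), so every base-angle derivative falls under the level integral, and for a real
profile and a real jointly smooth family the first-order jet is the real level box of the call (B-1 (x) per level with the kernel `K e`).
* `contDiff_levelIntegrand_pp₂`, `contDiff_levelLoopIntegral_pp₂`, **`iteratedDeriv_levelIntegral_pp_eq₂`** — (B3) with `Ψ(e, ·)`;
* **`iteratedDeriv_one_tubePiece_eq₂`**, **`norm_iteratedDeriv_one_tubePiece_eq₂`** — `‖∂_θ ∫ f(e)(∫ J(e,φ+θ)·K e (ē) dφ) de‖ = |∫_{−hi}^{hi} f(e) ∫_{−π}^{π} J·G·(K e)′(ē)|`.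
Sizes binder shape; pure bookkeeping on landed objects; nothing asserts (C), K3 or superconductivity.
References: FST II CPAM 51 (1998) §3 [cite: FeldmanSalmhoferTrubowitz1998]; BGM 2006 §2.4 (2.40) [cite: BenfattoGiulianiMastropietro2006].
-/

noncomputable section

namespace Summit.HubbardSuperconductivity.HubbardSuperconductivity.Theorems.C4a

set_option linter.dupNamespace false -- summit = problem name (single-conjunct summit), D-0017

open Real Set Filter MeasureTheory intervalIntegral
open scoped Topology ContDiff
open Literature.MathematicalPhysics.QuantumLattice Literature.MathematicalPhysics.QuantumLattice.BandSectorCounting Literature.Probability.LatticeModels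
open Summit.HubbardSuperconductivity.HubbardSuperconductivity.Theorems.KLRegimeSplit
open Summit.HubbardSuperconductivity.HubbardSuperconductivity.Theorems.DispersionFlow
open Summit.HubbardSuperconductivity.HubbardSuperconductivity.Theorems.PerturbedFermiCurve

/-! ## §1 (B3) with a level-dependent kernel -/

section Tube

variable {a b : ℝ} (B : BandBounds a b) {K : TrigPolyC4v} {A : ℝ}
  (hA : ∀ p : Momentum, ∀ j ≤ 2, ‖iteratedFDeriv ℝ j (frameShift K) p‖ ≤ A) (hADt : 2 * A < B.Dtmin)
  {μ r : ℝ} (hlo : a < μ - r - A) (hhi : μ + r + A < b)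
include B hA hADt hlo hhi

/-- **The cut-off pp integrand with a level-dependent kernel is jointly `C^∞`**: `f` smooth with `tsupport f ⊆ (−r, r)`, `Ψ : ℝ × ℝ → ℂ` jointly smooth ⟹
`(φ,(e,θ)) ↦ f(e)·(J(e,φ+θ)•Ψ(e, ē(e,φ;ρ′,ϑ′,θ)))` is `C^∞` on `ℝ × ℝ²`. -/
theorem contDiff_levelIntegrand_pp₂ {f : ℝ → ℂ} (hf : ContDiff ℝ ∞ f) (hfsupp : tsupport f ⊆ Ioo (-r) r) {Ψ : ℝ × ℝ → ℂ} (hΨ : ContDiff ℝ ∞ Ψ)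
    {ρ' : ℝ} (hρ' : |ρ'| < r) (ϑ' : ℝ) :
    ContDiff ℝ ∞ fun q : ℝ × (ℝ × ℝ) => f q.2.1 * ((levelChartJac μ K (q.2.1, q.1 + q.2.2) : ℝ) •
      Ψ (q.2.1, frameLevel μ K (levelPoint μ K 0 q.2.2 + levelPoint μ K ρ' (ϑ' + q.2.2) - levelPoint μ K q.2.1 (q.1 + q.2.2)))) := by
  have h0 : |(0 : ℝ)| < r := by rw [abs_zero]; exact (abs_nonneg ρ').trans_lt hρ'
  have hT : IsOpen ({ρ : ℝ | |ρ| < r} ×ˢ (univ : Set ℝ)) := (isOpen_lt continuous_abs continuous_const).prod isOpen_univ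
  have hl : ∀ {x : ℝ}, |x| < r → ContDiff ℝ ∞ (levelPoint μ K x) := fun hx => contDiff_levelPoint_angle B hA hADt hlo hhi hx
  have hc : ContDiff ℝ ∞ fun q : ℝ × (ℝ × ℝ) => ((q.2.1, q.1 + q.2.2) : ℝ × ℝ) :=
    (contDiff_fst.comp contDiff_snd).prodMk (contDiff_fst.add (contDiff_snd.comp contDiff_snd))
  refine contDiff_mul_of_tsupport_subset_strip (ℓ := fun q : ℝ × (ℝ × ℝ) => q.2.1) (contDiff_fst.comp contDiff_snd) (fun q hq => ?_) hf hfsupp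
  have hmem : ((q.2.1, q.1 + q.2.2) : ℝ × ℝ) ∈ {ρ : ℝ | |ρ| < r} ×ˢ (univ : Set ℝ) := mk_mem_prod hq (mem_univ _)
  have hJ : ContDiffAt ℝ ∞ (fun q : ℝ × (ℝ × ℝ) => levelChartJac μ K (q.2.1, q.1 + q.2.2)) q := by
    exact ContDiffAt.comp (g := levelChartJac μ K) (f := fun q : ℝ × (ℝ × ℝ) => ((q.2.1, q.1 + q.2.2) : ℝ × ℝ)) q
      ((contDiffOn_levelChartJac B hA hADt hlo hhi).contDiffAt (hT.mem_nhds hmem)) hc.contDiffAt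
  have hΦ : ContDiffAt ℝ ∞ (fun q : ℝ × (ℝ × ℝ) => levelPoint μ K q.2.1 (q.1 + q.2.2)) q := by
    exact ContDiffAt.comp (g := fun p : ℝ × ℝ => levelPoint μ K p.1 p.2) (f := fun q : ℝ × (ℝ × ℝ) => ((q.2.1, q.1 + q.2.2) : ℝ × ℝ)) q
      ((contDiffOn_levelPoint B hA hADt hlo hhi (m := ⊤)).contDiffAt (hT.mem_nhds hmem)) hc.contDiffAt
  have hE : ContDiffAt ℝ ∞ (fun q : ℝ × (ℝ × ℝ) =>
      frameLevel μ K (levelPoint μ K 0 q.2.2 + levelPoint μ K ρ' (ϑ' + q.2.2) - levelPoint μ K q.2.1 (q.1 + q.2.2))) q :=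
    (EngineV8.contDiff_frameLevel μ K).contDiffAt.comp q
      (((((hl h0).comp (contDiff_snd.comp contDiff_snd)).add
        ((hl hρ').comp (contDiff_const.add (contDiff_snd.comp contDiff_snd)))).contDiffAt).sub hΦ)
  have hpair : ContDiffAt ℝ ∞ (fun q : ℝ × (ℝ × ℝ) =>
      ((q.2.1, frameLevel μ K (levelPoint μ K 0 q.2.2 + levelPoint μ K ρ' (ϑ' + q.2.2) - levelPoint μ K q.2.1 (q.1 + q.2.2))) : ℝ × ℝ)) q :=
    (contDiff_fst.comp contDiff_snd).contDiffAt.prodMk hE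
  exact hJ.smul (hΨ.contDiffAt.comp q hpair)

/-- **`(e, θ) ↦ f(e)·∫ J(e,φ+θ)•Ψ(e,ē) dφ` is jointly `C^∞`.** -/
theorem contDiff_levelLoopIntegral_pp₂ {f : ℝ → ℂ} (hf : ContDiff ℝ ∞ f) (hfsupp : tsupport f ⊆ Ioo (-r) r) {Ψ : ℝ × ℝ → ℂ} (hΨ : ContDiff ℝ ∞ Ψ)
    {ρ' : ℝ} (hρ' : |ρ'| < r) (ϑ' : ℝ) :
    ContDiff ℝ ∞ fun p : ℝ × ℝ => f p.1 * ∫ φ in Ioo (-π) π,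
      (levelChartJac μ K (p.1, φ + p.2) : ℝ) • Ψ (p.1, frameLevel μ K (levelPoint μ K 0 p.2 + levelPoint μ K ρ' (ϑ' + p.2) - levelPoint μ K p.1 (φ + p.2))) := by
  have h := contDiff_loopCircleIntegral_param (contDiff_levelIntegrand_pp₂ B hA hADt hlo hhi hf hfsupp hΨ hρ' ϑ')
  have heq : (fun p : ℝ × ℝ => f p.1 * ∫ φ in Ioo (-π) π, (levelChartJac μ K (p.1, φ + p.2) : ℝ) •
      Ψ (p.1, frameLevel μ K (levelPoint μ K 0 p.2 + levelPoint μ K ρ' (ϑ' + p.2) - levelPoint μ K p.1 (φ + p.2)))) =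
      fun p : ℝ × ℝ => ∫ φ in Ioo (-π) π, f p.1 * ((levelChartJac μ K (p.1, φ + p.2) : ℝ) •
        Ψ (p.1, frameLevel μ K (levelPoint μ K 0 p.2 + levelPoint μ K ρ' (ϑ' + p.2) - levelPoint μ K p.1 (φ + p.2)))) :=
    funext fun p => (MeasureTheory.integral_const_mul _ _).symm
  rw [heq]
  exact h

/-- **EVERY BASE-ANGLE DERIVATIVE OF THE TUBE PIECE WITH A LEVEL-DEPENDENT KERNEL**: `∂ᵏ_θ ∫ f(e)·(∫ J(e,φ+θ)•Ψ(e,ē) dφ) de = ∫ f(e)·(∫ ∂ᵏ_θ[J•Ψ(e,ē)] dφ) de`. -/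
theorem iteratedDeriv_levelIntegral_pp_eq₂ {f : ℝ → ℂ} (hf : ContDiff ℝ ∞ f) (hfsupp : tsupport f ⊆ Ioo (-r) r) {Ψ : ℝ × ℝ → ℂ} (hΨ : ContDiff ℝ ∞ Ψ)
    {ρ' : ℝ} (hρ' : |ρ'| < r) (ϑ' : ℝ) (k : ℕ) (θ : ℝ) :
    iteratedDeriv k (fun θ : ℝ => ∫ e in Ioo (-r) r, f e * ∫ φ in Ioo (-π) π,
        (levelChartJac μ K (e, φ + θ) : ℝ) • Ψ (e, frameLevel μ K (levelPoint μ K 0 θ + levelPoint μ K ρ' (ϑ' + θ) - levelPoint μ K e (φ + θ)))) θ =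
      ∫ e in Ioo (-r) r, f e * ∫ φ in Ioo (-π) π, iteratedDeriv k (fun θ : ℝ =>
        (levelChartJac μ K (e, φ + θ) : ℝ) • Ψ (e, frameLevel μ K (levelPoint μ K 0 θ + levelPoint μ K ρ' (ϑ' + θ) - levelPoint μ K e (φ + θ)))) θ := by
  have hG := contDiff_levelLoopIntegral_pp₂ B hA hADt hlo hhi hf hfsupp hΨ hρ' ϑ'
  rw [iteratedDeriv_levelIntervalIntegral_eq (-r) r hG k θ]
  refine setIntegral_congr_fun measurableSet_Ioo fun e he => ?_
  have he' : |e| < r := abs_lt.2 he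
  have hΨe : ContDiff ℝ ∞ fun u : ℝ => Ψ (e, u) := hΨ.comp (contDiff_const.prodMk contDiff_id)
  have hI := contDiff_loopIntegral_pp B hA hADt hlo hhi hΨe hρ' he' ϑ'
  show iteratedDeriv k (fun θ : ℝ => f e * ∫ φ in Ioo (-π) π,
      (levelChartJac μ K (e, φ + θ) : ℝ) • Ψ (e, frameLevel μ K (levelPoint μ K 0 θ + levelPoint μ K ρ' (ϑ' + θ) - levelPoint μ K e (φ + θ)))) θ = _
  rw [iteratedDeriv_const_mul (f e) (hI.contDiffAt.of_le (by exact_mod_cast (le_top : (k : ℕ∞) ≤ ⊤))),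
    iteratedDeriv_loopIntegral_pp_eq B hA hADt hlo hhi hΨe hρ' he' ϑ' k θ]

end Tube

/-! ## §2 The first-order jet of the tube piece for a real profile and a real kernel family -/

section Sizes

variable {K : TrigPolyC4v} {A : ℝ} (hA : ∀ p : Momentum, ∀ j ≤ 2, ‖iteratedFDeriv ℝ j (frameShift K) p‖ ≤ A) (hA20 : A ≤ 1 / 20)
  (hd : klCurveD ≤ (bandBounds (show (-4 : ℝ) < -1.1 by norm_num) (show (-1.1 : ℝ) ≤ -0.1 by norm_num)
    (show (-0.1 : ℝ) < 0 by norm_num)).Dtmin - 2 * A)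
  {μ r : ℝ} (hr : 0 < r) (hlo : (-1.1 : ℝ) < μ - r - A) (hhi : μ + r + A < -0.1)
  {A₃ A₄ : ℝ} (hA₃ : ∀ p : Momentum, ‖iteratedFDeriv ℝ 3 (frameShift K) p‖ ≤ A₃)
  (hA₄ : ∀ p : Momentum, ‖iteratedFDeriv ℝ 4 (frameShift K) p‖ ≤ A₄)
  {K₁ : ℝ} (hK₁ : ∀ p : Momentum, ‖fderiv ℝ (frameLevel μ K) p‖ ≤ K₁)
include hA hA20 hd hr hlo hhi hA₃ hA₄ hK₁

/-- **THE FIRST-ORDER CO-MOVING JET OF THE TUBE PIECE, REAL KERNEL FAMILY** (HEADLINE): `f` real `C^∞` with `tsupport f ⊆ (−hi, hi)`, `0 ≤ hi < r`; `K : ℝ → ℝ → ℝ`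
jointly `C^∞` with `|K e u| ≤ M₀`, `|∂ᵤK e u| ≤ M₁`; `|ρ| < r`.  Then
`∂_θ ∫_{(−r,r)} f(e)·(∫_{(−π,π)} J(e,φ+θ)·K e (ē) dφ) de = ((∫_{−hi}^{hi} f(e)·(∫_{−π}^{π} J(e,v+θ₀)·G·(K e)′(ē) dv) de : ℝ) : ℂ)`. [cite: BenfattoGiulianiMastropietro2006, §2.4 (2.40)] -/
theorem iteratedDeriv_one_tubePiece_eq₂ {f : ℝ → ℝ} (hf : ContDiff ℝ ∞ f) {hi : ℝ} (hhi0 : 0 ≤ hi) (hhir : hi < r) (hfsupp : tsupport f ⊆ Ioo (-hi) hi)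
    {Kr : ℝ → ℝ → ℝ} (hK : ContDiff ℝ ∞ fun p : ℝ × ℝ => Kr p.1 p.2) {M₀ M₁ : ℝ} (hK0 : ∀ e x, |Kr e x| ≤ M₀) (hK1 : ∀ e x, |deriv (Kr e) x| ≤ M₁)
    {ρ : ℝ} (hρ : |ρ| < r) (ϑ θ₀ : ℝ) :
    iteratedDeriv 1 (fun θ : ℝ => ∫ e in Ioo (-r) r, ((f e : ℝ) : ℂ) * ∫ φ in Ioo (-π) π,
        (levelChartJac μ K (e, φ + θ) : ℝ) • ((Kr e (frameLevel μ K (levelPoint μ K 0 θ + levelPoint μ K ρ (ϑ + θ) - levelPoint μ K e (φ + θ))) : ℝ) : ℂ)) θ₀ =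
      (((∫ e in (-hi)..hi, f e * ∫ v in (-π)..π, levelChartJac μ K (e, v + θ₀) *
          (fderiv ℝ (frameLevel μ K) (pairSumPath μ K ρ ϑ θ₀ 0 - levelPoint μ K e (v + θ₀)))
            (iteratedDeriv 1 (levelPoint μ K 0) θ₀ + iteratedDeriv 1 (levelPoint μ K ρ) (ϑ + θ₀)) *
        deriv (Kr e) (frameLevel μ K (pairSumPath μ K ρ ϑ θ₀ 0 - levelPoint μ K e (v + θ₀))) : ℝ) : ℂ)) := by
  set B₀ := bandBounds (show (-4 : ℝ) < -1.1 by norm_num) (show (-1.1 : ℝ) ≤ -0.1 by norm_num) (show (-0.1 : ℝ) < 0 by norm_num) with hB₀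
  have hADt : 2 * A < B₀.Dtmin := by have := klCurveD_pos; linarith only [this, hd]
  set fc : ℝ → ℂ := fun e => ((f e : ℝ) : ℂ) with hfc
  have hfcC : ContDiff ℝ ∞ fc := Complex.ofRealCLM.contDiff.comp hf
  have hfcsupp : tsupport fc ⊆ Ioo (-r) r := by
    have h1 : tsupport fc ⊆ tsupport f := by
      refine closure_mono fun e he => ?_
      simp only [Function.mem_support, ne_eq, hfc, Complex.ofReal_eq_zero] at he ⊢
      exact he
    exact h1.trans (hfsupp.trans (Ioo_subset_Ioo (by linarith) hhir.le))
  set Ψ : ℝ × ℝ → ℂ := fun p => ((Kr p.1 p.2 : ℝ) : ℂ) with hΨdef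
  have hΨ : ContDiff ℝ ∞ Ψ := Complex.ofRealCLM.contDiff.comp hK
  have hB3 := iteratedDeriv_levelIntegral_pp_eq₂ B₀ hA hADt hlo hhi hfcC hfcsupp hΨ hρ ϑ 1 θ₀
  rw [show (fun θ : ℝ => ∫ e in Ioo (-r) r, ((f e : ℝ) : ℂ) * ∫ φ in Ioo (-π) π,
        (levelChartJac μ K (e, φ + θ) : ℝ) • ((Kr e (frameLevel μ K (levelPoint μ K 0 θ + levelPoint μ K ρ (ϑ + θ) - levelPoint μ K e (φ + θ))) : ℝ) : ℂ)) =
      fun θ : ℝ => ∫ e in Ioo (-r) r, fc e * ∫ φ in Ioo (-π) π,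
        (levelChartJac μ K (e, φ + θ) : ℝ) • Ψ (e, frameLevel μ K (levelPoint μ K 0 θ + levelPoint μ K ρ (ϑ + θ) - levelPoint μ K e (φ + θ))) from rfl, hB3]
  -- per level line: B-1 (x) with the kernel `K e`
  have hline : ∀ e ∈ Ioo (-r) r, (∫ φ in Ioo (-π) π, iteratedDeriv 1 (fun θ : ℝ =>
        (levelChartJac μ K (e, φ + θ) : ℝ) • Ψ (e, frameLevel μ K (levelPoint μ K 0 θ + levelPoint μ K ρ (ϑ + θ) - levelPoint μ K e (φ + θ)))) θ₀) =
      (((∫ v in (-π)..π, levelChartJac μ K (e, v + θ₀) *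
          (fderiv ℝ (frameLevel μ K) (pairSumPath μ K ρ ϑ θ₀ 0 - levelPoint μ K e (v + θ₀)))
            (iteratedDeriv 1 (levelPoint μ K 0) θ₀ + iteratedDeriv 1 (levelPoint μ K ρ) (ϑ + θ₀)) *
        deriv (Kr e) (frameLevel μ K (pairSumPath μ K ρ ϑ θ₀ 0 - levelPoint μ K e (v + θ₀))) : ℝ) : ℂ)) := by
    intro e he
    have he' : |e| < r := abs_lt.2 he
    have hΨe : ContDiff ℝ ∞ fun u : ℝ => Ψ (e, u) := hΨ.comp (contDiff_const.prodMk contDiff_id)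
    have hKe : ContDiff ℝ ∞ (Kr e) := hK.comp (contDiff_const.prodMk contDiff_id)
    rw [← iteratedDeriv_loopIntegral_pp_eq B₀ hA hADt hlo hhi hΨe hρ he' ϑ 1 θ₀, iteratedDeriv_one]
    exact loopIntegral_firstOrder_ofReal hA hA20 hd hr hlo hhi hA₃ hA₄ hK₁ (hKe.of_le (by norm_cast)) (hK0 e) (hK1 e) hρ he' ϑ θ₀
  rw [setIntegral_congr_fun measurableSet_Ioo fun e he => by simp only [hfc]; rw [hline e he]]
  simp_rw [← Complex.ofReal_mul]
  rw [integral_complex_ofReal]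
  congr 1
  rw [intervalIntegral.integral_of_le (by linarith), integral_Ioc_eq_integral_Ioo]
  refine setIntegral_eq_of_subset_of_forall_sdiff_eq_zero measurableSet_Ioo (Ioo_subset_Ioo (by linarith) hhir.le) fun e he => ?_
  have hfe : f e = 0 := by
    have : e ∉ tsupport f := fun h => he.2 (hfsupp h)
    exact image_eq_zero_of_notMem_tsupport this
  rw [hfe, zero_mul]

/-- **… and its norm** = the level box of `firstOrderLayer_abs_le` with the weight `f`, the Jacobian family `J(e, v+θ₀)` and the kernel family `K e`. -/
theorem norm_iteratedDeriv_one_tubePiece_eq₂ {f : ℝ → ℝ} (hf : ContDiff ℝ ∞ f) {hi : ℝ} (hhi0 : 0 ≤ hi) (hhir : hi < r) (hfsupp : tsupport f ⊆ Ioo (-hi) hi)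
    {Kr : ℝ → ℝ → ℝ} (hK : ContDiff ℝ ∞ fun p : ℝ × ℝ => Kr p.1 p.2) {M₀ M₁ : ℝ} (hK0 : ∀ e x, |Kr e x| ≤ M₀) (hK1 : ∀ e x, |deriv (Kr e) x| ≤ M₁)
    {ρ : ℝ} (hρ : |ρ| < r) (ϑ θ₀ : ℝ) :
    ‖iteratedDeriv 1 (fun θ : ℝ => ∫ e in Ioo (-r) r, ((f e : ℝ) : ℂ) * ∫ φ in Ioo (-π) π,
        (levelChartJac μ K (e, φ + θ) : ℝ) • ((Kr e (frameLevel μ K (levelPoint μ K 0 θ + levelPoint μ K ρ (ϑ + θ) - levelPoint μ K e (φ + θ))) : ℝ) : ℂ)) θ₀‖ =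
      |∫ e in (-hi)..hi, f e * ∫ v in (-π)..π, levelChartJac μ K (e, v + θ₀) *
          (fderiv ℝ (frameLevel μ K) (pairSumPath μ K ρ ϑ θ₀ 0 - levelPoint μ K e (v + θ₀)))
            (iteratedDeriv 1 (levelPoint μ K 0) θ₀ + iteratedDeriv 1 (levelPoint μ K ρ) (ϑ + θ₀)) *
        deriv (Kr e) (frameLevel μ K (pairSumPath μ K ρ ϑ θ₀ 0 - levelPoint μ K e (v + θ₀)))| := by
  rw [iteratedDeriv_one_tubePiece_eq₂ hA hA20 hd hr hlo hhi hA₃ hA₄ hK₁ hf hhi0 hhir hfsupp hK hK0 hK1 hρ ϑ θ₀, Complex.norm_real, Real.norm_eq_abs]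

end Sizes

end Summit.HubbardSuperconductivity.HubbardSuperconductivity.Theorems.C4a

end
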